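import Summits.PneNP.PneNP.Theorems.RamseyNotNP.Negative.Sandwich

/-!
# `RamseyNotNP` (stmt-PneNP-9814) — negative-side lemmas: the threshold `k n = n` is an infinite language in `P`

Companion of `ThresholdLoadBearing.lean` (cdisprove, gen 1).  A data point between the dead zones of the
crux shape `RamseyNotNPAt k`: at `k n = n` the Ramsey set is the set of NON-HOMOGENEOUS graphs (`G ≠ ⊤`,
`G ≠ ⊥`), infinite and co-infinite among code words, yet its language is in `P` (`ramseyLangAt_self_mem_P`,
a `CodeFP` non-homogeneity test on the adjacency bits), so `¬ RamseyNotNPAt (fun n => n)`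
(`not_ramseyNotNPAt_self`) although the necessary conditions of `ThresholdLoadBearing` §5 hold
(`ramseySetAt_self_infinite`).  The crux shape is therefore NOT monotone in the threshold: dead for
`4^k ≤ n`, conjectured at `⌈2log₂ n⌉`, dead again from `k = n` on.

Refuter seat cdisprove-stmt-PneNP-9814, 2026-08-16.
-/

-- `Summit.PneNP.PneNP.…` duplicates `PneNP` BY DESIGN (single-problem summit, D-0017).
set_option linter.dupNamespace false

namespace Summit.PneNP.PneNP.Theorems.RamseyNotNP.Negative

open Literature.Computability.Complexity _root_.Computability
open Summit.PneNP.PneNP.Theses.RamseyUncertifiable (RamseyNotNP RamseyInCoNP)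

/-! ## §11 A data point between the dead zones: the threshold `k n = n` gives an infinite language in `P`

At `k n = n` the Ramsey set is the set of NON-HOMOGENEOUS graphs (`G ≠ ⊤`, `G ≠ ⊥`, `n ≥ 2`): infinite and
co-infinite among code words, yet in `P` — the necessary conditions of §5 are far from sufficient, and the
crux shape is NOT monotone in the threshold (dead for `4^k ≤ n`, conjectured at `2log₂ n`, plausibly
`⟺ coNP ≠ NP` at polynomial thresholds `n^ε` by padding CLIQUE into explicit Frankl–Wilson hosts — not
formalised —, dead again from `k = n` on). -/

/-- The non-homogeneity test on the fields of a code: some bit is set, and some off-diagonal bit is clear.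
[folklore] -/
def nonHomTest (q : ℕ × List Bool) : Bool :=
  ((List.range q.2.length).any fun t => q.2.getD t false) &&
    ((List.range q.2.length).any fun t => (!q.2.getD t false) && !decide (t / q.1 = t % q.1))

/-- `nonHomTest` is computed on codes in polynomial time. [folklore] -/
theorem nonHomTest_codeFP : CodeFP (CodeFP.pairE CodeFP.natE CodeFP.strE) CodeFP.bitE nonHomTest := by
  have hn : CodeFP (CodeFP.pairE CodeFP.natE CodeFP.strE) CodeFP.natE (fun q : ℕ × List Bool => q.1) :=
    CodeFP.fst _ _
  have hbits : CodeFP (CodeFP.pairE CodeFP.natE CodeFP.strE) CodeFP.strE (fun q : ℕ × List Bool => q.2) :=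
    CodeFP.snd _ _
  have hrange : CodeFP (CodeFP.pairE CodeFP.natE CodeFP.strE) (CodeFP.rawE CodeFP.natE)
      (fun q : ℕ × List Bool => List.range q.2.length) :=
    CodeFP.urange.comp (CodeFP.strLength.comp hbits)
  have gn : CodeFP (CodeFP.pairE (CodeFP.pairE CodeFP.natE CodeFP.strE) CodeFP.natE) CodeFP.natE
      (fun r : (ℕ × List Bool) × ℕ => r.1.1) := hn.comp (CodeFP.fst _ _)
  have gbits : CodeFP (CodeFP.pairE (CodeFP.pairE CodeFP.natE CodeFP.strE) CodeFP.natE) CodeFP.strE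
      (fun r : (ℕ × List Bool) × ℕ => r.1.2) := hbits.comp (CodeFP.fst _ _)
  have gt : CodeFP (CodeFP.pairE (CodeFP.pairE CodeFP.natE CodeFP.strE) CodeFP.natE) CodeFP.natE
      (fun r : (ℕ × List Bool) × ℕ => r.2) := CodeFP.snd _ _
  have gb : CodeFP (CodeFP.pairE (CodeFP.pairE CodeFP.natE CodeFP.strE) CodeFP.natE) CodeFP.bitE
      (fun r : (ℕ × List Bool) × ℕ => r.1.2.getD r.2 false) :=
    CodeFP.strGetDNat.comp (gbits.pair gt)
  have gd : CodeFP (CodeFP.pairE (CodeFP.pairE CodeFP.natE CodeFP.strE) CodeFP.natE) CodeFP.bitE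
      (fun r : (ℕ × List Bool) × ℕ => decide (r.2 / r.1.1 = r.2 % r.1.1)) :=
    CodeFP.natEq.comp ((CodeFP.natDiv.comp (gt.pair gn)).pair (CodeFP.natMod.comp (gt.pair gn)))
  have e1 : CodeFP (CodeFP.pairE CodeFP.natE CodeFP.strE) CodeFP.bitE
      (fun q : ℕ × List Bool => (List.range q.2.length).any fun t => q.2.getD t false) :=
    (CodeFP.any gb).comp ((CodeFP.id _).pair hrange)
  have e2 : CodeFP (CodeFP.pairE CodeFP.natE CodeFP.strE) CodeFP.bitE
      (fun q : ℕ × List Bool => (List.range q.2.length).any fun t =>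
        (!q.2.getD t false) && !decide (t / q.1 = t % q.1)) :=
    (CodeFP.any (gb.not.and gd.not)).comp ((CodeFP.id _).pair hrange)
  exact e1.and e2

/-- An `n`-clique of a graph on `Fin n` is everything, so a missing edge excludes `n`-cliques. [folklore] -/
theorem cliqueFree_card_of_not_adj {n : ℕ} {G : SimpleGraph (Fin n)} {i j : Fin n} (hij : i ≠ j)
    (h : ¬ G.Adj i j) : G.CliqueFree n := by
  intro s hs
  have hsu : s = Finset.univ :=
    Finset.eq_univ_of_card s (hs.card_eq.trans (Fintype.card_fin n).symm)
  subst hsu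
  exact h (hs.isClique (Finset.mem_univ i) (Finset.mem_univ j) hij)

open Classical in
/-- **What the test decides**: on the code fields of `G`, `nonHomTest` holds iff `G` has no `n`-clique and
no `n`-independent set. [folklore] -/
theorem nonHomTest_adjBits (n : ℕ) (G : SimpleGraph (Fin n)) :
    nonHomTest (n, CliqueNP.adjBits n G) = true ↔ (G.CliqueFree n ∧ Gᶜ.CliqueFree n) := by
  simp only [nonHomTest, CliqueNP.length_adjBits, Bool.and_eq_true, List.any_eq_true, List.mem_range,
    Bool.not_eq_true', decide_eq_false_iff_not]
  constructor
  · rintro ⟨⟨t, ht, hbit⟩, ⟨u, hu, hbit', hne⟩⟩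
    rw [CliqueNP.getD_adjBits G ht, decide_eq_true_eq] at hbit
    rw [CliqueNP.getD_adjBits G hu] at hbit'
    have hadj' : ¬ G.Adj ⟨u / n, CliqueNP.div_lt_of_lt_mul hu⟩ ⟨u % n, Nat.mod_lt _ (CliqueNP.pos_of_lt_mul hu)⟩ := by
      intro h; rw [decide_eq_true h] at hbit'; exact Bool.noConfusion hbit'
    refine ⟨cliqueFree_card_of_not_adj (fun h => hne (by simpa using congrArg Fin.val h)) hadj', ?_⟩
    refine cliqueFree_card_of_not_adj (G := Gᶜ) (G.ne_of_adj hbit) ?_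
    rw [SimpleGraph.compl_adj]
    exact fun h => h.2 hbit
  · rintro ⟨hG, hGc⟩
    constructor
    · -- `G ≠ ⊥`: otherwise `Gᶜ = ⊤` has an `n`-clique
      by_contra hno
      push Not at hno
      apply not_cliqueFree_top (le_refl n)
      have : Gᶜ = ⊤ := by
        ext i j
        simp only [SimpleGraph.compl_adj, SimpleGraph.top_adj, ne_eq, and_iff_left_iff_imp]
        intro hij hadj
        have h := hno (i * n + j) (CliqueNP.flat_lt i j)
        rw [CliqueNP.getD_adjBits_flat, decide_eq_true hadj] at h
        exact h rfl
      rw [← this]; exact hGc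
    · -- `G ≠ ⊤`: otherwise `G` has an `n`-clique
      by_contra hno
      push Not at hno
      apply not_cliqueFree_top (le_refl n)
      have : G = ⊤ := by
        ext i j
        simp only [SimpleGraph.top_adj, ne_eq]
        constructor
        · exact fun h => G.ne_of_adj h
        · intro hij
          have h := hno (i * n + j) (CliqueNP.flat_lt i j)
          rw [CliqueNP.getD_adjBits_flat, CliqueNP.flat_div, CliqueNP.flat_mod] at h
          by_contra hadj
          exact hij (Fin.ext (h (decide_eq_false hadj)))
      rw [← this]; exact hG

/-- **The threshold `n` language is in `P`** (code-word test ∧ non-homogeneity test). [folklore] -/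
theorem ramseyLangAt_self_mem_P : ramseyLangAt (fun n => n) ∈ Classes.P := by
  obtain ⟨f, hf, hspec⟩ := nonHomTest_codeFP
  have key : ∀ (n : ℕ) (G : SimpleGraph (Fin n)),
      f (encodingGraph.encode ⟨n, G⟩) = [nonHomTest (n, CliqueNP.adjBits n G)] := fun n G => by
    rw [HamNP.encode_eq]; exact hspec (n, CliqueNP.adjBits n G)
  have heq : ramseyLangAt (fun n => n) = HamNP.gcodeLang ⊓ ({x | f x = [true]} : Language Bool) := by
    refine Set.ext fun x => ⟨?_, ?_⟩
    · rintro ⟨⟨n, G⟩, hG, rfl⟩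
      refine ⟨(HamNP.mem_gcodeLang_iff _).2 ⟨n, G, rfl⟩, ?_⟩
      show f (encodingGraph.encode ⟨n, G⟩) = [true]
      rw [key, (nonHomTest_adjBits n G).2 hG]
    · rintro ⟨hx, hfx⟩
      obtain ⟨n, G, rfl⟩ := (HamNP.mem_gcodeLang_iff x).1 hx
      have hfx' : f (encodingGraph.encode ⟨n, G⟩) = [true] := hfx
      rw [key] at hfx'
      exact ⟨⟨n, G⟩, (nonHomTest_adjBits n G).1 (List.cons.inj hfx').1, rfl⟩
  rw [heq]
  exact inter_mem_P HamNP.gcodeLang_mem_P (setOf_apply_eq_apply_mem_P hf (const_mem_FP [true]))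

/-- **`¬ RamseyNotNPAt (fun n => n)`.** [folklore] -/
theorem not_ramseyNotNPAt_self : ¬ RamseyNotNPAt (fun n => n) :=
  fun h => h (P_subset_NP_holds ramseyLangAt_self_mem_P)

/-- The threshold-`n` language is nevertheless infinite: a single edge on `m + 3` vertices is
non-homogeneous. [folklore] -/
theorem ramseySetAt_self_infinite : (ramseySetAt fun n => n).Infinite := by
  let Gm : ∀ m : ℕ, SimpleGraph (Fin (m + 3)) := fun m =>
    SimpleGraph.fromRel fun i j : Fin (m + 3) => i.val = 0 ∧ j.val = 1
  have hmem : ∀ m : ℕ, (⟨m + 3, Gm m⟩ : Σ n, SimpleGraph (Fin n)) ∈ ramseySetAt fun n => n := by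
    intro m
    have h01 : (Gm m).Adj ⟨0, by omega⟩ ⟨1, by omega⟩ := by
      simp [Gm, SimpleGraph.fromRel_adj]
    have h02 : ¬ (Gm m).Adj ⟨0, by omega⟩ ⟨2, by omega⟩ := by
      simp [Gm, SimpleGraph.fromRel_adj]
    show (Gm m).CliqueFree (m + 3) ∧ (Gm m)ᶜ.CliqueFree (m + 3)
    refine ⟨cliqueFree_card_of_not_adj (i := ⟨0, by omega⟩) (j := ⟨2, by omega⟩) (by simp) h02, ?_⟩
    refine cliqueFree_card_of_not_adj (G := (Gm m)ᶜ) (i := ⟨0, by omega⟩) (j := ⟨1, by omega⟩)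
      (by simp) ?_
    rw [SimpleGraph.compl_adj]
    exact fun h => h.2 h01
  have hinj : Function.Injective fun m : ℕ => (⟨m + 3, Gm m⟩ : Σ n, SimpleGraph (Fin n)) := by
    intro a b hab
    have := congrArg Sigma.fst hab
    simpa using this
  exact Set.infinite_of_injective_forall_mem hinj hmem

end Summit.PneNP.PneNP.Theorems.RamseyNotNP.Negative
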